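import Mathlib
import Literature.Probability.Process.CondExpProductFibre
import HarnessLib

/-!
# Route SpecificationCompactness · support `GibbsLimitUniqueness` (stmt-QuantumFields-28253) — generic kernel:
# single-link resampling operators on a product of compact probability spaces, their DOEBLIN contraction, and the
# identification of the conditional expectation given all links but one with the fibre integral

THE NEW KERNEL of the line (Friedli–Velenik, *Statistical Mechanics of Lattice Systems* (2017) Lemma 6.27 pattern +
Doeblin's minorisation): on `X = ι → G` (finitely many links, `G` compact with a probability measure `η`) the operators
`Γ_e g (V) = ∫ q_e(V[e ↦ w]) g(V[e ↦ w]) dη(w)` for a continuous weight `q` with a floor `δ > 0` and unit fibre integrals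
are positive, unital, preserve continuity, and a FULL SWEEP `Γ = Γ_{e₁} ⋯ Γ_{eₙ}` is minorised by `δⁿ` times a fixed state:
`Γ g ≥ δⁿ · m(g)` for `g ≥ 0`.  Consequently the oscillation of `Γ^k f` is at most `(1 - δⁿ)^k · osc f`, and ANY sequence of
states `E_K` with `E_K(Γ_e g) - E_K(g) → 0` for all `e`, `g` has `E_K(f)` CAUCHY for every continuous `f`
(`exists_tendsto_of_doeblin`) — no compactness of the space of measures, no Riesz representation is needed.

§1 `exists_tendsto_of_doeblin` — the abstract contraction/Cauchy argument (pure real analysis over an abstract operator `Γ`,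
   minorising state `m`, states `E_K`, and a class `good` of test functions).
§2 `map_apply_restrict_pi`, `condExp_pi_ae_eq_integral_update` — under the product measure `⊗ η` the conditional expectation
   given the links `≠ e` is the fibre integral `V ↦ ∫ g(V[e ↦ a]) dη(a)` (the tree's `CondExpProductFibre` disintegration lemma
   instantiated at the reconstruction map `(a, V|_{≠e}) ↦ V[e ↦ a]`).
§3 the single-link / sweep operators (written with `List.foldr`, def-free): continuity, affinity, positivity, the `δ^{|l|}`
   minorisation by the pure resampling sweep, and locality of the pure sweep.

HONEST FRAMING: measure-theoretic plumbing [folklore]; nothing about the YM mass gap, no rung and no summit statement is proved here.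
Sources: S. Friedli, Y. Velenik, *Statistical Mechanics of Lattice Systems*, CUP 2017, Lemma 6.27 / Thm 6.26 (doi:10.1017/9781316882603, bib FriedliVelenik2017);
W. Doeblin's minorisation, e.g. Meyn–Tweedie, *Markov Chains and Stochastic Stability* (1993) Thm 16.0.2 (bib MeynTweedie1993);
O. Kallenberg, *Foundations of Modern Probability* (2002) Thm 6.4 (via `Literature.Probability.Process.condExp_comap_ae_eq_integral_comp_recon`).
-/

noncomputable section

namespace Summit.QuantumFields.YangMills.Theorems.GibbsLimitUniqueness

open MeasureTheory Filter Topology Function Set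

/-! ## §1 The abstract Doeblin contraction and the Cauchy argument -/

/-- **DOEBLIN ⇒ CONVERGENCE OF STATES THAT ARE ASYMPTOTICALLY `Γ`-INVARIANT.**  Let `good` be a class of bounded test functions on a
non-empty type `X`, closed under `Γ` and under affine maps `f ↦ a·f + b`; let `Γ` commute with affine maps (positivity + unitality in
the form used), let `m` be an affine functional with the MINORISATION `Γ f ≥ c · m(f)` for `good f ≥ 0` (`c > 0`), and let `E_K`
be monotone normalised functionals (`a ≤ f ≤ b ⇒ a ≤ E_K f ≤ b`) with `E_K(Γ f) - E_K(f) → 0` for every good `f`.  Then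
`(E_K f)_K` converges for every good `f`: `osc(Γ^k f) ≤ (1-c)^k osc(f)` (Doeblin), so `E_K f` is within `osc(Γ^k f) + o(1)` of
`E_{K'} f` — a Cauchy sequence of reals. [cite: MeynTweedie1993, Thm 16.0.2 (Doeblin minorisation)] -/
theorem exists_tendsto_of_doeblin {X : Type*} [Nonempty X] (good : (X → ℝ) → Prop)
    (Γ : (X → ℝ) → (X → ℝ)) (m : (X → ℝ) → ℝ) (E : ℕ → (X → ℝ) → ℝ) {c : ℝ} (hc : 0 < c)
    (hgood : ∀ f, good f → good (Γ f))
    (haff : ∀ f (a b : ℝ), good f → good (fun V => a * f V + b))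
    (hbdd : ∀ f, good f → ∃ a b : ℝ, ∀ V, a ≤ f V ∧ f V ≤ b)
    (hΓaff : ∀ f (a b : ℝ), good f → Γ (fun V => a * f V + b) = fun V => a * Γ f V + b)
    (hmaff : ∀ f (a b : ℝ), good f → m (fun V => a * f V + b) = a * m f + b)
    (hmin : ∀ f, good f → (∀ V, 0 ≤ f V) → ∀ V, c * m f ≤ Γ f V)
    (hE : ∀ K f (a b : ℝ), good f → (∀ V, a ≤ f V ∧ f V ≤ b) → a ≤ E K f ∧ E K f ≤ b)
    (hinv : ∀ f, good f → Tendsto (fun K => E K (Γ f) - E K f) atTop (𝓝 0))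
    {f : X → ℝ} (hf : good f) : ∃ l : ℝ, Tendsto (fun K => E K f) atTop (𝓝 l) := by
  classical
  -- `c ≤ 1`: the minorisation tested on the constant function `1 = 0·f + 1`
  have hc1 : c ≤ 1 := by
    obtain ⟨V⟩ := ‹Nonempty X›
    have h1 : good (fun V => (0:ℝ) * f V + 1) := haff f 0 1 hf
    have h := hmin _ h1 (fun V => by norm_num) V
    rw [hmaff f 0 1 hf, hΓaff f 0 1 hf] at h
    simp only [zero_mul, zero_add, mul_one] at h
    exact h
  -- one Doeblin step: `Γ g ∈ [c·m g + (1-c)·a, c·m g + (1-c)·b]` when `g ∈ [a, b]`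
  have step : ∀ g (a b : ℝ), good g → (∀ V, a ≤ g V ∧ g V ≤ b) →
      ∀ V, c * m g + (1 - c) * a ≤ Γ g V ∧ Γ g V ≤ c * m g + (1 - c) * b := by
    intro g a b hg hab V
    have hlo := hmin _ (haff g 1 (-a) hg) (fun W => by have := (hab W).1; linarith) V
    have hhi := hmin _ (haff g (-1) b hg) (fun W => by have := (hab W).2; linarith) V
    rw [hmaff g 1 (-a) hg, hΓaff g 1 (-a) hg] at hlo
    rw [hmaff g (-1) b hg, hΓaff g (-1) b hg] at hhi
    simp only at hlo hhi
    constructor <;> nlinarith [hlo, hhi, hc, hc1]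
  obtain ⟨a, b, hab⟩ := hbdd f hf
  have hgood_iter : ∀ k, good (Γ^[k] f) := by
    intro k
    induction k with
    | zero => simpa using hf
    | succ k ih => rw [Function.iterate_succ_apply']; exact hgood _ ih
  -- `k` Doeblin steps: the oscillation of `Γ^[k] f` is at most `(1-c)^k (b - a)`
  have osc : ∀ k : ℕ, ∃ a' b' : ℝ, (∀ V, a' ≤ (Γ^[k] f) V ∧ (Γ^[k] f) V ≤ b') ∧
      b' - a' = (1 - c) ^ k * (b - a) := by
    intro k
    induction k with
    | zero => exact ⟨a, b, by simpa using hab, by ring⟩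
    | succ k ih =>
      obtain ⟨a', b', hab', hosc⟩ := ih
      refine ⟨c * m (Γ^[k] f) + (1 - c) * a', c * m (Γ^[k] f) + (1 - c) * b', fun V => ?_, ?_⟩
      · rw [Function.iterate_succ_apply']; exact step _ a' b' (hgood_iter k) hab' V
      · rw [pow_succ, ← sub_sub, show c * m (Γ^[k] f) + (1 - c) * b' - c * m (Γ^[k] f) - (1 - c) * a'
            = (1 - c) * (b' - a') by ring, hosc]; ring
  -- `E_K (Γ^[k] f) - E_K f → 0` for every `k`
  have hinv_iter : ∀ k : ℕ, Tendsto (fun K => E K (Γ^[k] f) - E K f) atTop (𝓝 0) := by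
    intro k
    induction k with
    | zero => simp only [Function.iterate_zero, id_eq, sub_self]; exact tendsto_const_nhds
    | succ k ih =>
      have h := (hinv _ (hgood_iter k)).add ih
      rw [add_zero] at h
      refine h.congr' (Eventually.of_forall fun K => ?_)
      simp only [Function.iterate_succ_apply']; ring
  -- the Cauchy argument
  have hcauchy : CauchySeq fun K => E K f := by
    refine Metric.cauchySeq_iff'.2 fun ε hε => ?_
    have hq : Tendsto (fun k : ℕ => (1 - c) ^ k * (b - a)) atTop (𝓝 0) := by
      have h := (tendsto_pow_atTop_nhds_zero_of_lt_one (show (0:ℝ) ≤ 1 - c by linarith)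
        (show (1:ℝ) - c < 1 by linarith)).mul_const (b - a)
      simpa using h
    obtain ⟨k, hk⟩ := (hq.eventually (gt_mem_nhds (show (0:ℝ) < ε / 3 by linarith))).exists
    obtain ⟨a', b', hab', hosc⟩ := osc k
    obtain ⟨N, hN⟩ := (Metric.tendsto_atTop.1 (hinv_iter k)) (ε / 3) (by linarith)
    refine ⟨N, fun n hn => ?_⟩
    have h1 := hN n hn
    have h2 := hN N le_rfl
    rw [Real.dist_0_eq_abs, abs_lt] at h1 h2
    have h3 := hE n _ a' b' (hgood_iter k) hab'
    have h4 := hE N _ a' b' (hgood_iter k) hab'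
    rw [Real.dist_eq, abs_lt]
    constructor <;> linarith [h3.1, h3.2, h4.1, h4.2]
  exact cauchySeq_tendsto_of_complete hcauchy


/-! ## §2 Product measure: the conditional expectation given the links `≠ e` is the fibre integral -/

section Product

variable {ι : Type*} [Fintype ι] [DecidableEq ι] {G : Type*} [MeasurableSpace G]

/-- Under the product measure `⊗_ι η` (`η` a probability measure) the joint law of (the `e`-th coordinate, the remaining
coordinates) is the product `η ⊗ (⊗_{ι∖e} η)` — Mathlib's `measurePreserving_piEquivPiSubtypeProd` at the predicate `(· = e)`
followed by `piUnique` on the one-point factor. [cite: Kallenberg2002, Lemma 3.10 (product measures)] -/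
theorem map_apply_restrict_pi (η : Measure G) [IsProbabilityMeasure η] (e : ι) :
    (Measure.pi fun _ : ι => η).map (fun W : ι → G => (W e, fun b : {b // b ≠ e} => W b.1))
      = η.prod (Measure.pi fun _ : {b // b ≠ e} => η) := by
  have hφ := measurePreserving_piEquivPiSubtypeProd (fun _ : ι => η) (fun b => b = e)
  letI hFin : Fintype {b // b = e} := Subtype.fintype fun b => b = e
  have hψ := measurePreserving_piUnique (fun _ : {b // b = e} => η)
  have h := (hψ.prod (MeasurePreserving.id (Measure.pi fun _ : {b // ¬ b = e} => η))).comp hφ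
  have hfun : (Prod.map (MeasurableEquiv.piUnique fun _ : {b // b = e} => G) id) ∘
      (MeasurableEquiv.piEquivPiSubtypeProd (fun _ : ι => G) fun b => b = e)
      = fun W : ι → G => (W e, fun b : {b // b ≠ e} => W b.1) := by
    funext W
    rfl
  rw [hfun] at h
  exact h.map_eq

/-- **CONDITIONING A PRODUCT MEASURE ON ALL COORDINATES BUT ONE = INTEGRATING THAT COORDINATE OUT.**  For the product
`Π = ⊗_ι η` of a probability measure and a strongly measurable `Π`-integrable `g`:
`Π[g | σ(W ↦ W|_{ι∖e})] (W) = ∫ g(W[e ↦ a]) dη(a)` for `Π`-a.e. `W` — Kallenberg's disintegration formula in the independent case,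
via the tree's `condExp_comap_ae_eq_integral_comp_recon` at the reconstruction map `(a, W|_{≠e}) ↦ W[e ↦ a]`.
[cite: Kallenberg2002, Thm 6.4 eq. (6); Lemma 3.11] -/
theorem condExp_pi_ae_eq_integral_update (η : Measure G) [IsProbabilityMeasure η] (e : ι)
    {g : (ι → G) → ℝ} (hgm : StronglyMeasurable g) (hgi : Integrable g (Measure.pi fun _ : ι => η)) :
    (Measure.pi fun _ : ι => η)[g | MeasurableSpace.comap (fun (W : ι → G) (b : {b // b ≠ e}) => W b.1)
        MeasurableSpace.pi]
      =ᵐ[Measure.pi fun _ : ι => η] fun W => ∫ a, g (Function.update W e a) ∂η := by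
  set R : G × ({b // b ≠ e} → G) → (ι → G) := fun p b => if h : b = e then p.1 else p.2 ⟨b, h⟩ with hR_def
  have hR : Measurable R := by
    refine measurable_pi_lambda _ fun b => ?_
    by_cases h : b = e
    · have hc : (fun p : G × ({b // b ≠ e} → G) => R p b) = fun p => p.1 := by
        funext p; simp [hR_def, h]
      rw [hc]; exact measurable_fst
    · have hc : (fun p : G × ({b // b ≠ e} → G) => R p b) = fun p => p.2 ⟨b, h⟩ := by
        funext p; simp [hR_def, h]
      rw [hc]; exact (measurable_pi_apply _).comp measurable_snd
  have hT : Measurable fun W : ι → G => W e := measurable_pi_apply e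
  have hS : Measurable fun (W : ι → G) (b : {b // b ≠ e}) => W b.1 :=
    measurable_pi_lambda _ fun b => measurable_pi_apply b.1
  have hRTS : ∀ W : ι → G, R (W e, fun b : {b // b ≠ e} => W b.1) = W := by
    intro W; funext b
    by_cases h : b = e
    · subst h; simp [hR_def]
    · simp [hR_def, h]
  have h := Literature.Probability.Process.condExp_comap_ae_eq_integral_comp_recon
    (μ := Measure.pi fun _ : ι => η) (ν := η) (π := Measure.pi fun _ : {b // b ≠ e} => η)
    hT hS (map_apply_restrict_pi η e) hR hRTS hgm hgi
  refine h.trans (Eventually.of_forall fun W => ?_)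
  refine integral_congr_ae (Eventually.of_forall fun a => ?_)
  show g (R (a, fun b : {b // b ≠ e} => W b.1)) = g (Function.update W e a)
  congr 1
  funext b
  by_cases hb : b = e
  · subst hb; simp [hR_def]
  · simp [hR_def, hb]

end Product

/-! ## §3 Single-link resampling operators and sweeps on `ι → G` -/

section LinkOpsBasic

variable {ι : Type*} [DecidableEq ι] {G : Type*} [MeasurableSpace G] (η : Measure G)

/-- Sweeps with non-negative weights are POSITIVE. [cite: FriedliVelenik2017, Lemma 6.27] -/
theorem sweep_nonneg {q : ι → (ι → G) → ℝ} (hq0 : ∀ e V, 0 ≤ q e V) {f : (ι → G) → ℝ} (hf0 : ∀ V, 0 ≤ f V) :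
    ∀ (l : List ι) (V : ι → G), 0 ≤ l.foldr (fun e g => fun V : ι → G =>
      ∫ w, q e (Function.update V e w) * g (Function.update V e w) ∂η) f V
  | [], V => by simpa using hf0 V
  | e :: l, V => by
    rw [List.foldr_cons]
    exact integral_nonneg fun w => mul_nonneg (hq0 e _) (sweep_nonneg hq0 hf0 l _)

/-- LOCALITY OF THE PURE RESAMPLING SWEEP: `P_l f (V)` depends only on the coordinates of `V` OFF `l` (each resampled coordinate is
integrated out with a constant weight).  In particular a full sweep `P_{l₀} f`, `l₀ ⊇ ι`, is a CONSTANT function. [folklore] -/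
theorem pureSweep_eq_of_eqOn_compl {f : (ι → G) → ℝ} :
    ∀ (l : List ι) (V V' : ι → G), (∀ i, i ∉ l → V i = V' i) →
      l.foldr (fun e g => fun V : ι → G =>
          ∫ w, (fun (_ : ι) (_ : ι → G) => (1:ℝ)) e (Function.update V e w) * g (Function.update V e w) ∂η) f V
        = l.foldr (fun e g => fun V : ι → G =>
          ∫ w, (fun (_ : ι) (_ : ι → G) => (1:ℝ)) e (Function.update V e w) * g (Function.update V e w) ∂η) f V'
  | [], V, V', h => by
    have hVV' : V = V' := funext fun i => h i (by simp)
    simp [hVV']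
  | e :: l, V, V', h => by
    rw [List.foldr_cons]
    refine integral_congr_ae (Eventually.of_forall fun w => ?_)
    have hupd : ∀ i, i ∉ l → Function.update V e w i = Function.update V' e w i := by
      intro i hi
      by_cases hie : i = e
      · subst hie; simp
      · rw [Function.update_of_ne hie, Function.update_of_ne hie]
        exact h i (by simp [hie, hi])
    show (1:ℝ) * _ = (1:ℝ) * _
    rw [pureSweep_eq_of_eqOn_compl l _ _ hupd]

end LinkOpsBasic

section LinkOps

variable {ι : Type*} [Fintype ι] [DecidableEq ι] {G : Type*} [TopologicalSpace G] [CompactSpace G]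
  [FirstCountableTopology G] [MeasurableSpace G] [OpensMeasurableSpace G] (η : Measure G) [IsProbabilityMeasure η]

omit [Fintype ι] [FirstCountableTopology G] in
/-- A continuous function composed with `w ↦ V[e ↦ w]` is `η`-integrable (bounded on the compact product, continuous in `w`).
[folklore] -/
theorem integrable_comp_update {h : (ι → G) → ℝ} (hh : Continuous h) (e : ι) (V : ι → G) :
    Integrable (fun w => h (Function.update V e w)) η := by
  obtain ⟨C, hC⟩ := isCompact_univ.exists_bound_of_continuousOn (hh.continuousOn (s := Set.univ))
  exact Integrable.of_bound (hh.comp (continuous_const.update e continuous_id)).aestronglyMeasurable C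
    (Eventually.of_forall fun w => hC _ (Set.mem_univ _))

/-- The fibre integral `V ↦ ∫ h(V[e ↦ w]) dη(w)` of a continuous `h` is CONTINUOUS (dominated convergence with a constant
bound on the compact product). [cite: FriedliVelenik2017, Lemma 6.27 (Feller property of the specification kernels)] -/
theorem continuous_integral_update {h : (ι → G) → ℝ} (hh : Continuous h) (e : ι) :
    Continuous fun V : ι → G => ∫ w, h (Function.update V e w) ∂η := by
  obtain ⟨C, hC⟩ := isCompact_univ.exists_bound_of_continuousOn (hh.continuousOn (s := Set.univ))
  exact continuous_of_dominated
    (F := fun (V : ι → G) (w : G) => h (Function.update V e w)) (bound := fun _ => C) (μ := η)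
    (fun V => (hh.comp (continuous_const.update e continuous_id)).aestronglyMeasurable)
    (fun V => Eventually.of_forall fun w => hC _ (Set.mem_univ _))
    (integrable_const C)
    (Eventually.of_forall fun w => hh.comp (continuous_id.update e continuous_const))

/-- A SWEEP `Γ_l f = Γ_{e₁}(Γ_{e₂}(⋯ Γ_{eₖ} f))`, `Γ_e g (V) = ∫ q_e(V[e↦w]) g(V[e↦w]) dη(w)`, of a continuous `f` with continuous
weights is continuous. [cite: FriedliVelenik2017, Lemma 6.27] -/
theorem continuous_sweep {q : ι → (ι → G) → ℝ} (hq : ∀ e, Continuous (q e)) {f : (ι → G) → ℝ} (hf : Continuous f) :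
    ∀ l : List ι, Continuous (l.foldr (fun e g => fun V : ι → G =>
      ∫ w, q e (Function.update V e w) * g (Function.update V e w) ∂η) f)
  | [] => by simpa using hf
  | e :: l => by
    rw [List.foldr_cons]
    exact continuous_integral_update η ((hq e).mul (continuous_sweep hq hf l)) e

/-- SWEEPS COMMUTE WITH AFFINE MAPS `f ↦ a·f + b` when every weight has unit fibre integrals (`∫ q_e(V[e↦w]) dη(w) = 1`):
linearity of the integral plus unitality. [cite: FriedliVelenik2017, Lemma 6.27] -/
theorem sweep_affine {q : ι → (ι → G) → ℝ} (hq : ∀ e, Continuous (q e))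
    (hnorm : ∀ e (V : ι → G), ∫ w, q e (Function.update V e w) ∂η = 1)
    {f : (ι → G) → ℝ} (hf : Continuous f) (a b : ℝ) :
    ∀ l : List ι, l.foldr (fun e g => fun V : ι → G =>
        ∫ w, q e (Function.update V e w) * g (Function.update V e w) ∂η) (fun V => a * f V + b)
      = fun V => a * l.foldr (fun e g => fun V : ι → G =>
        ∫ w, q e (Function.update V e w) * g (Function.update V e w) ∂η) f V + b
  | [] => by simp
  | e :: l => by
    rw [List.foldr_cons, List.foldr_cons, sweep_affine hq hnorm hf a b l]
    funext V
    have hg := continuous_sweep η hq hf l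
    set g := l.foldr (fun e g => fun V : ι → G =>
        ∫ w, q e (Function.update V e w) * g (Function.update V e w) ∂η) f with hg_def
    have h1 : Integrable (fun w => q e (Function.update V e w) * g (Function.update V e w)) η :=
      integrable_comp_update η ((hq e).mul hg) e V
    have h2 : Integrable (fun w => q e (Function.update V e w)) η := integrable_comp_update η (hq e) e V
    calc ∫ w, q e (Function.update V e w) * (a * g (Function.update V e w) + b) ∂η
        = ∫ w, (a * (q e (Function.update V e w) * g (Function.update V e w))
            + b * q e (Function.update V e w)) ∂η := by
          congr 1; funext w; ring
      _ = a * ∫ w, q e (Function.update V e w) * g (Function.update V e w) ∂η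
            + b * ∫ w, q e (Function.update V e w) ∂η := by
          rw [integral_add (h1.const_mul a) (h2.const_mul b), integral_const_mul, integral_const_mul]
      _ = a * ∫ w, q e (Function.update V e w) * g (Function.update V e w) ∂η + b := by
          rw [hnorm e V, mul_one]

/-- **DOEBLIN MINORISATION OF A SWEEP BY THE PURE RESAMPLING SWEEP**: if every weight is continuous with `q_e ≥ δ ≥ 0`, then for
continuous `f ≥ 0`, `Γ_l f ≥ δ^{|l|} · P_l f` pointwise, where `P_l` is the same sweep with all weights `≡ 1`.
[cite: MeynTweedie1993, Thm 16.0.2 (minorisation)] -/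
theorem sweep_ge_pow_mul_pureSweep {q : ι → (ι → G) → ℝ} (hq : ∀ e, Continuous (q e)) {δ : ℝ} (hδ : 0 ≤ δ)
    (hqδ : ∀ e V, δ ≤ q e V) {f : (ι → G) → ℝ} (hf : Continuous f) (hf0 : ∀ V, 0 ≤ f V) :
    ∀ (l : List ι) (V : ι → G),
      δ ^ l.length * l.foldr (fun e g => fun V : ι → G =>
          ∫ w, (fun (_ : ι) (_ : ι → G) => (1:ℝ)) e (Function.update V e w) * g (Function.update V e w) ∂η) f V
        ≤ l.foldr (fun e g => fun V : ι → G =>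
          ∫ w, q e (Function.update V e w) * g (Function.update V e w) ∂η) f V
  | [], V => by simp
  | e :: l, V => by
    have hq0 : ∀ e V, 0 ≤ q e V := fun e V => hδ.trans (hqδ e V)
    have h1c : Continuous (fun (_ : ι → G) => (1:ℝ)) := continuous_const
    set P := l.foldr (fun e g => fun V : ι → G =>
        ∫ w, (fun (_ : ι) (_ : ι → G) => (1:ℝ)) e (Function.update V e w) * g (Function.update V e w) ∂η) f
      with hP_def
    set T := l.foldr (fun e g => fun V : ι → G =>
        ∫ w, q e (Function.update V e w) * g (Function.update V e w) ∂η) f with hT_def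
    have hPc : Continuous P := continuous_sweep η (q := fun (_ : ι) (_ : ι → G) => (1:ℝ)) (fun _ => h1c) hf l
    have hTc : Continuous T := continuous_sweep η hq hf l
    have hP0 : ∀ V, 0 ≤ P V := sweep_nonneg η (q := fun (_ : ι) (_ : ι → G) => (1:ℝ)) (fun _ _ => zero_le_one) hf0 l
    have ih : ∀ V, δ ^ l.length * P V ≤ T V := sweep_ge_pow_mul_pureSweep hq hδ hqδ hf hf0 l
    rw [List.foldr_cons, List.foldr_cons, List.length_cons, pow_succ]
    show δ ^ l.length * δ * ∫ w, 1 * P (Function.update V e w) ∂η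
        ≤ ∫ w, q e (Function.update V e w) * T (Function.update V e w) ∂η
    calc δ ^ l.length * δ * ∫ w, 1 * P (Function.update V e w) ∂η
        = ∫ w, δ * (δ ^ l.length * P (Function.update V e w)) ∂η := by
          rw [← integral_const_mul]; congr 1; funext w; ring
      _ ≤ ∫ w, q e (Function.update V e w) * T (Function.update V e w) ∂η := by
          refine integral_mono (((integrable_comp_update η hPc e V).const_mul (δ ^ l.length)).const_mul δ)
            (integrable_comp_update η ((hq e).mul hTc) e V) fun w => ?_
          exact le_trans (mul_le_mul_of_nonneg_right (hqδ e _) (mul_nonneg (pow_nonneg hδ _) (hP0 _)))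
            (mul_le_mul_of_nonneg_left (ih _) (hq0 e _))

end LinkOps

end Summit.QuantumFields.YangMills.Theorems.GibbsLimitUniqueness

end
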